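import Mathlib
import Summits.ValiantsHypothesis.ValiantsHypothesis.Theorems.GrenetZeonDualUnipotentThreeHalvesSlowCoreLedger

/-!
# Crux `GrenetZeon.TwoDimCoefficients` (stmt-ValiantsHypothesis-8062) / rung `DualUnipotentThreeHalves` (stmt-24318):
# scaling-closure — BLOCK-DIAGONAL BOOKKEEPING: the trace `tr(N^k·M)` splits over the class pencils

Plumbing (P1 of memo NINETEENTH-HAND.md §10) for the mass cut in Hessian currency (✓ `sq_sub_mul_le_of_tracePowParts_add_supportPart`,
p838341): if the pencil `N` is BLOCK-DIAGONAL for a labelling `lvl` (`N a b = 0` whenever `lvl a ≠ lvl b`), then for every `M`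
and every `k`

  `tr(N^k·M) = Σ_{p ∈ levels} tr((N|_p)^k · M|_p)`,

with `N|_p = classPencil N e_p` the class pencil of ✓ `…SlowCoreLedger` (re-indexed by `Fin s_p`).  So the normal form
`per_n = tr(N^{n−1} M)` (✓ `exists_nilpotent_pencil_of_dualUnipotentRepr`) of a representation with block-diagonal `N` IS a decomposition
`per_n = Σ_p tr(N_p^{n−1} M_p)` into constituents, ready for the Hessian mass cut.

* `pow_apply_eq_zero_of_lvl_ne` — powers of a block-diagonal matrix are block-diagonal;
* ★ `trace_pow_mul_eq_sum_classPencil` — the splitting above.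

HONEST FRAMING: unconditional plumbing; proves no rung: the stub `DualUnipotentBound`, crux 8062, the 24318 decl and `VP ≠ VNP` remain open.

References: folklore.
-/

-- single-conjunct layout `Summits/ValiantsHypothesis/ValiantsHypothesis`: the duplicated namespace
-- component is mandated by the tree.
set_option linter.dupNamespace false
set_option autoImplicit false

noncomputable section

namespace Summit.ValiantsHypothesis.ValiantsHypothesis.Theorems.GrenetZeonTwoDimCoefficients.ScalingClosure

open MvPolynomial Matrix
open Summit.ValiantsHypothesis.ValiantsHypothesis.Cruxes.TwoDimCoefficients.DimTwoCases
open Summit.ValiantsHypothesis.ValiantsHypothesis.Theorems.GrenetZeon.SlowCore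

section BlockDiagTrace

variable {R : Type*} [CommRing R] {m : ℕ}

/-- Powers of a block-diagonal matrix are block-diagonal. [folklore] -/
theorem pow_apply_eq_zero_of_lvl_ne (lvl : Fin m → ℕ) (N : Matrix (Fin m) (Fin m) R)
    (hdiag : ∀ a b, lvl a ≠ lvl b → N a b = 0) (k : ℕ) (a b : Fin m) (hab : lvl a ≠ lvl b) :
    (N ^ k) a b = 0 := by
  rcases lt_or_gt_of_ne hab with h | h
  · exact pow_apply_eq_zero_of_lvl_lt lvl N (fun i j hij => hdiag i j (ne_of_lt hij)) k a b h
  · -- reverse the labelling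
    obtain ⟨L, hL⟩ : ∃ L, ∀ i, lvl i ≤ L := by
      classical
      refine ⟨Finset.univ.sup lvl, fun i => Finset.le_sup (Finset.mem_univ i)⟩
    have h' := pow_apply_eq_zero_of_lvl_lt (fun i => L - lvl i) N
      (fun i j hij => hdiag i j (by have := hL i; have := hL j; omega)) k a b
      (by have := hL a; have := hL b; omega)
    exact h'

variable {n : ℕ}

/-- ★ **Block-diagonal bookkeeping.**  For a block-diagonal pencil `N` (labelling `lvl`, class equivalences `e p`), every `M` and every
`k`: `tr(N^k·M) = Σ_{p ∈ lvl(univ)} tr((classPencil N (e p))^k · classPencil M (e p))`. [folklore] -/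
theorem trace_pow_mul_eq_sum_classPencil (lvl : Fin m → ℕ) (N M : AffMat n m)
    (hdiag : ∀ a b, lvl a ≠ lvl b → N a b = 0) (s : ℕ → ℕ)
    (e : ∀ p : ℕ, {i : Fin m // lvl i = p} ≃ Fin (s p)) (k : ℕ) :
    (N ^ k * M).trace = ∑ p ∈ Finset.univ.image lvl, ((classPencil N (e p)) ^ k * classPencil M (e p)).trace := by
  classical
  have hbu : ∀ i j, lvl i < lvl j → N i j = 0 := fun i j hij => hdiag i j (ne_of_lt hij)
  -- fibrewise over the level of the row index
  rw [Matrix.trace, ← Finset.sum_fiberwise_of_maps_to (g := lvl) (t := Finset.univ.image lvl)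
    (fun a ha => Finset.mem_image_of_mem lvl ha)]
  refine Finset.sum_congr rfl fun p _ => ?_
  -- the class `p`, as a sum over the subtype, re-indexed by `Fin (s p)`
  have hclass : ∑ a ∈ Finset.univ.filter (fun a => lvl a = p), (N ^ k * M) a a =
      ∑ a' : Fin (s p), (N ^ k * M) (classEmb (e p) a') (classEmb (e p) a') := by
    rw [Finset.sum_subtype (Finset.univ.filter (fun a => lvl a = p)) (p := fun a => lvl a = p) (by simp)]
    rw [← Fintype.sum_equiv (e p).symm (fun a' => (N ^ k * M) (classEmb (e p) a') (classEmb (e p) a'))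
      (fun x => (N ^ k * M) (x : Fin m) (x : Fin m)) (fun a' => rfl)]
  simp only [Matrix.diag_apply]
  rw [hclass, Matrix.trace]
  refine Finset.sum_congr rfl fun a' _ => ?_
  rw [Matrix.diag_apply, Matrix.mul_apply, Matrix.mul_apply]
  -- drop the summands outside the class, then re-index the class by `Fin (s p)`
  have hin : ∑ b, (N ^ k) (classEmb (e p) a') b * M b (classEmb (e p) a') =
      ∑ b ∈ Finset.univ.filter (fun b => lvl b = p), (N ^ k) (classEmb (e p) a') b * M b (classEmb (e p) a') := by
    rw [← Finset.sum_filter_add_sum_filter_not Finset.univ (fun b => lvl b = p), add_eq_left]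
    refine Finset.sum_eq_zero fun b hb => ?_
    rw [Finset.mem_filter] at hb
    rw [pow_apply_eq_zero_of_lvl_ne lvl N hdiag k _ b (by rw [lvl_classEmb (e p) a']; exact Ne.symm hb.2), zero_mul]
  rw [hin, Finset.sum_subtype (Finset.univ.filter (fun b => lvl b = p)) (p := fun b => lvl b = p) (by simp),
    ← Fintype.sum_equiv (e p).symm
      (fun c' => (N ^ k) (classEmb (e p) a') (classEmb (e p) c') * M (classEmb (e p) c') (classEmb (e p) a'))
      (fun x => (N ^ k) (classEmb (e p) a') (x : Fin m) * M (x : Fin m) (classEmb (e p) a')) (fun c' => rfl)]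
  refine Finset.sum_congr rfl fun c' _ => ?_
  rw [classPencil, submatrix_pow_apply_of_levelCut N hbu (e p) k a' c', classPencil, Matrix.submatrix_apply]

end BlockDiagTrace

end Summit.ValiantsHypothesis.ValiantsHypothesis.Theorems.GrenetZeonTwoDimCoefficients.ScalingClosure

end
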